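import Summits.QuantumFields.BalabanUV.T4Continuum.Support.NE7FlatGradientLetterBlockDiv
import HarnessLib

/-!
# NE7FlatGradientLogCurlPrep — PREPARATION FOR THE FLAT C¹ COMPACT LETTER PART (iv) (the LOG-INTERPOLATED curl datum): the Calderón–Zygmund ∕ Dini shell
# computation for the dipole kernel against a bounded, Lipschitz, compactly supported scalar density `φ` — near shells `|x − y|_∞ < ρ` carry the OSCILLATION
# `b′`, the cut at radius `ρ` costs two shells of the SIZE `b`, far shells are summed by parts onto the second-difference kernel:
# `|Σ_y dG₀ μ (x−y)·(φ(y) − φ(y−e_ν))| ≤ C₁(1 + Aρ)·b′ + 2A·C₁·b + C₂·2^d·A·(1 + log⁺((2R+3)∕ρ))·b` (`A = 2d·3^{d−1}`)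

Cell `pub-balaban`, rung (B)+1 sub-cell t4; written by the row-NE7b OWNER lineage `b2b-balaban-t4-ne7b-p1` (gen 154) for the sibling crux row NE7 (lineage `t4-ne7-p1`,
gen 107's INTERFACE REQUEST NE7→NE7b stub (S-c) PART (iv), `HOME/INBOX.md` [NE7P1-G107-INBOX-2]: «the curl part through the Dini∕CZ shell computation
`Σ_{shells r} min(2B, r·B′)·(dipole row at distance r) ≈ B + 2B·log⁺(RB′∕B)` instead of the plain dipole row `(R+1)·B′`»).  Consumed by `NE7FlatGradientLetterLogCurl`.
THE BRICKS ([folklore]; 0 def, 0 sorry; over pv23's `Beta/PoissonInterior` and gen 154's `NE7FlatGradientModulusPrep`).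
§1 `sum_shell_inv_nrm_pow_pred_le` (one shell `|z|_∞ = j ≥ 1` weighs `≤ A` against `nrm^{1−d}`), `sum_two_shells_le` (`ρ − 1 ≤ |z|_∞ ≤ ρ`, `ρ ≥ 2`: `≤ 2A`),
   `curlAt_flat_eq_zero_of_not_mem` (the flat curl of a field vanishing off `cube c R` vanishes off `cube c (R+1)`).
§2 **`kernel_sum_bdiff_le`** — THE SHELL COMPUTATION: `d ≥ 3`, `x ∈ cube c (R+1)`, `T = cube c (R+2)`, `φ : Site d → ℝ` vanishing off `cube c (R+1)` with `|φ| ≤ b` and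
   `|φ(y+e_λ) − φ(y)| ≤ b′`, `2 ≤ ρ`:  `|Σ_{y∈T} dG₀ μ (x−y)·(φ y − φ (y−e_ν))| ≤ C₁(1 + Aρ)·b′ + 2A·C₁·b + C₂2^d·A·(1 + log⁺((2R+3)∕ρ))·b`, the constants `C₁, C₂` being
   pv23's `G₀_diff_bound` ∕ `G₀_diff2_bound` envelopes (taken as hypotheses so that the caller fixes them once).
HONEST FRAMING (page 1): elementary lattice potential theory, flat, scalar; nothing of Bałaban's; NOT NE7, nothing of row NE7b (`T4WeightBudget.RelWeightBound` NOT PRINTED ∕ NOT PROVED);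
spine count = dagwriter∕referees' call; finite T⁴ rung (B)+1 — NOT infinite volume, NOT mass gap, NOT BetaPertH, NOT Clay.  Continuum YM on T⁴ ⇐ BetaPertH ∧ nine spine estimates
(0/9 proved); BetaPertH ⇐ (D1) ∧ (D4) ∧ CAP+tail; G-an2-4 gates asym, D1 and NE2/3/4.
-/

set_option autoImplicit false

open scoped BigOperators Matrix.Norms.L2Operator
open Finset

namespace Summit.QuantumFields.BalabanUV.T4Continuum.NE7FlatGradientLogCurlPrep

open Literature.MathematicalPhysics.QuantumFieldTheory.Balaban1983to89
open B7Prop1Explicit (Site e)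
open T4AveragingDeficitWall (curlAt)
open BlockAveragePushDirSplit (flat)
open Beta.PoissonInterior (cube mem_cube cube_mono mem_cube_zero_iff supNorm supNorm_le_iff natAbs_le_supNorm supNorm_add_le supNorm_neg
  supNorm_single_le nrm nrm_pos supNorm_le_nrm G₀ dG₀ sum_cube_inv_nrm_pow_le sum_shift card_shell_le)
open NE7FlatGradientLetterCompact (mem_cube_succ_of_add_e)
open NE7FlatGradientModulusPrep (sum_reflect_le sum_cube_far_inv_nrm_pow_le half_nrm_le_nrm_add)
open NE3SmoothLiftCurl (curlAt_flat_eq)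

noncomputable section

variable {d : ℕ} {n : Type*} [Fintype n] [DecidableEq n]

/-! ## §1 Shell sums against `nrm^{1−d}`; the support of the flat curl -/

omit [Fintype n] [DecidableEq n] in
/-- One shell `|z|_∞ = j ≥ 1` weighs at most `A = 2d·3^{d−1}` against `nrm^{1−d}`. [folklore] -/
theorem sum_shell_inv_nrm_pow_pred_le (hd : 0 < d) (R' j : ℕ) (hj : 1 ≤ j) :
    ∑ z ∈ (cube (0 : Site d) R').filter (fun z => supNorm z = j), 1 / nrm z ^ (d - 1) ≤ 2 * d * 3 ^ (d - 1) := by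
  have hj0 : (0 : ℝ) < j := by exact_mod_cast hj
  have hj1 : (1 : ℝ) ≤ j := by exact_mod_cast hj
  have hval : ∀ z ∈ (cube (0 : Site d) R').filter (fun z => supNorm z = j), 1 / nrm z ^ (d - 1) = 1 / (j : ℝ) ^ (d - 1) := by
    intro z hz
    rw [Finset.mem_filter] at hz
    have : nrm z = j := by unfold nrm; rw [hz.2]; exact max_eq_right hj1
    rw [this]
  rw [Finset.sum_congr rfl hval, Finset.sum_const, nsmul_eq_mul]
  have hc := card_shell_le hd R' j hj
  calc ((((cube (0 : Site d) R').filter (fun z => supNorm z = j)).card : ℝ)) * (1 / (j : ℝ) ^ (d - 1))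
      ≤ 2 * d * (2 * j + 1) ^ (d - 1) * (1 / (j : ℝ) ^ (d - 1)) := mul_le_mul_of_nonneg_right hc (by positivity)
    _ ≤ 2 * d * (3 * (j : ℝ)) ^ (d - 1) * (1 / (j : ℝ) ^ (d - 1)) := by
        apply mul_le_mul_of_nonneg_right _ (by positivity)
        apply mul_le_mul_of_nonneg_left _ (by positivity)
        exact pow_le_pow_left₀ (by positivity) (by linarith) _
    _ = 2 * d * 3 ^ (d - 1) := by
        rw [mul_pow]
        field_simp

omit [Fintype n] [DecidableEq n] in
/-- Two consecutive shells `ρ − 1 ≤ |z|_∞ ≤ ρ` (`ρ ≥ 2`) weigh at most `2A` against `nrm^{1−d}`. [folklore] -/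
theorem sum_two_shells_le (hd : 0 < d) (R' ρ : ℕ) (hρ : 2 ≤ ρ) :
    ∑ z ∈ (cube (0 : Site d) R').filter (fun z => ρ - 1 ≤ supNorm z ∧ supNorm z ≤ ρ), 1 / nrm z ^ (d - 1) ≤ 2 * (2 * d * 3 ^ (d - 1)) := by
  have hsplit : (cube (0 : Site d) R').filter (fun z => ρ - 1 ≤ supNorm z ∧ supNorm z ≤ ρ)
      = (cube (0 : Site d) R').filter (fun z => supNorm z = ρ - 1) ∪ (cube (0 : Site d) R').filter (fun z => supNorm z = ρ) := by
    ext z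
    simp only [Finset.mem_filter, Finset.mem_union]
    constructor
    · rintro ⟨hz, h1, h2⟩
      rcases Nat.eq_or_lt_of_le h2 with h | h
      · exact Or.inr ⟨hz, h⟩
      · exact Or.inl ⟨hz, by omega⟩
    · rintro (⟨hz, h⟩ | ⟨hz, h⟩) <;> exact ⟨hz, by omega, by omega⟩
  have hdisj : Disjoint ((cube (0 : Site d) R').filter (fun z => supNorm z = ρ - 1)) ((cube (0 : Site d) R').filter (fun z => supNorm z = ρ)) :=
    Finset.disjoint_filter.2 fun z _ h1 h2 => by omega
  rw [hsplit, Finset.sum_union hdisj]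
  have h1 := sum_shell_inv_nrm_pow_pred_le (d := d) hd R' (ρ - 1) (by omega)
  have h2 := sum_shell_inv_nrm_pow_pred_le (d := d) hd R' ρ (by omega)
  linarith

/-- The flat curl of a field vanishing off `cube c R` vanishes off `cube c (R+1)`. [folklore] -/
theorem curlAt_flat_eq_zero_of_not_mem {c : Site d} {R : ℕ} {Z : Site d → Fin d → Matrix n n ℂ}
    (hZ : ∀ x, x ∉ cube c R → Z x = 0) {y : Site d} (hy : y ∉ cube c (R + 1)) (μ ν : Fin d) :
    curlAt (flat (d := d) (n := n)) Z y μ ν = 0 := by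
  have h0 : Z y = 0 := hZ y fun h => hy (cube_mono (Nat.le_succ R) h)
  have h1 : Z (y + e μ) = 0 := hZ _ fun h => hy (mem_cube_succ_of_add_e h)
  have h2 : Z (y + e ν) = 0 := hZ _ fun h => hy (mem_cube_succ_of_add_e h)
  rw [curlAt_flat_eq]
  simp [h0, h1, h2]

/-! ## §2 The shell computation for the dipole kernel against a bounded Lipschitz density -/

omit [Fintype n] [DecidableEq n] in
/-- **THE SHELL COMPUTATION** (`d ≥ 3`; `C₁, C₂` the envelopes of `G₀_diff_bound`, `G₀_diff2_bound`): for `x ∈ cube c (R+1)`, `φ` real vanishing off `cube c (R+1)`,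
`|φ| ≤ b`, `|φ(y + e_λ) − φ(y)| ≤ b′`, and a radius `2 ≤ ρ`:
`|Σ_{y ∈ cube c (R+2)} dG₀ μ (x−y)·(φ y − φ (y−e_ν))| ≤ C₁(1 + Aρ)·b′ + 2A·C₁·b + C₂·2^d·A·(1 + log⁺((2R+3)∕ρ))·b`. [folklore] -/
theorem kernel_sum_bdiff_le (hd : 3 ≤ d) {C₁ C₂ : ℝ} (hC₁ : 0 ≤ C₁) (hC₂ : 0 ≤ C₂)
    (hK1 : ∀ (v : Site d) (i : Fin d), |dG₀ i v| ≤ C₁ / nrm v ^ (d - 1))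
    (hK2 : ∀ (v : Site d) (i j : Fin d), |dG₀ i (v + e j) - dG₀ i v| ≤ C₂ / nrm v ^ d)
    (c x : Site d) (R : ℕ) (hx : x ∈ cube c (R + 1)) (φ : Site d → ℝ) (hφ0 : ∀ y, y ∉ cube c (R + 1) → φ y = 0)
    {b b' : ℝ} (hb : ∀ y, |φ y| ≤ b) (hb' : ∀ (y : Site d) (lam : Fin d), |φ (y + e lam) - φ y| ≤ b')
    (μ ν : Fin d) (ρ : ℕ) (hρ : 2 ≤ ρ) :
    |∑ y ∈ cube c (R + 2), dG₀ μ (x - y) * (φ y - φ (y - e ν))|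
      ≤ C₁ * (1 + 2 * d * 3 ^ (d - 1) * ρ) * b' + 2 * (2 * d * 3 ^ (d - 1)) * C₁ * b
        + C₂ * 2 ^ d * (2 * d * 3 ^ (d - 1) * (1 + Real.posLog (((2 * R + 3 : ℕ) : ℝ) / ρ))) * b := by
  have hd0 : 0 < d := by omega
  have hb0 : 0 ≤ b := (abs_nonneg _).trans (hb x)
  have hb'0 : 0 ≤ b' := (abs_nonneg _).trans (hb' x μ)
  set T := cube c (R + 2) with hT
  set A : ℝ := 2 * d * 3 ^ (d - 1) with hA
  have hA0 : 0 ≤ A := by positivity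
  -- geometry of `T` seen from `x`
  have hxT : ∀ y ∈ T, x - y ∈ cube (0 : Site d) (2 * R + 3) := by
    intro y hy
    rw [mem_cube] at hx hy
    rw [mem_cube_zero_iff, supNorm_le_iff]
    intro i
    rw [Beta.PoissonInterior.natAbs_le_iff_abs_le, Pi.sub_apply]
    calc |x i - y i| = |(x i - c i) - (y i - c i)| := by ring_nf
      _ ≤ |x i - c i| + |y i - c i| := abs_sub _ _
      _ ≤ ((R + 1 : ℕ) : ℤ) + ((R + 2 : ℕ) : ℤ) := add_le_add (hx i) (hy i)
      _ = ((2 * R + 3 : ℕ) : ℤ) := by push_cast; ring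
  -- the cut density: near part `χφ`, far part `(1−χ)φ`, `χ(y) = [|x − y|_∞ < ρ]`
  set φn : Site d → ℝ := fun y => if supNorm (x - y) < ρ then φ y else 0 with hφn
  set φf : Site d → ℝ := fun y => if supNorm (x - y) < ρ then 0 else φ y with hφf
  have hsplit : ∀ y, φ y = φn y + φf y := fun y => by
    simp only [hφn, hφf]; split_ifs <;> simp
  have hsum : ∑ y ∈ T, dG₀ μ (x - y) * (φ y - φ (y - e ν))
      = ∑ y ∈ T, dG₀ μ (x - y) * (φn y - φn (y - e ν)) + ∑ y ∈ T, dG₀ μ (x - y) * (φf y - φf (y - e ν)) := by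
    rw [← Finset.sum_add_distrib]
    exact Finset.sum_congr rfl fun y _ => by rw [hsplit y, hsplit (y - e ν)]; ring
  -- NEAR: `φn y − φn (y−e) = χ(y)(φ y − φ(y−e)) + φ(y−e)(χ y − χ(y−e))`
  have hsupe : supNorm (e ν : Site d) ≤ 1 := supNorm_single_le ν 1
  have hnear_pt : ∀ y ∈ T, |dG₀ μ (x - y) * (φn y - φn (y - e ν))|
      ≤ C₁ * b' * (if supNorm (x - y) < ρ then 1 / nrm (x - y) ^ (d - 1) else 0)
        + C₁ * b * (if ρ - 1 ≤ supNorm (x - y) ∧ supNorm (x - y) ≤ ρ then 1 / nrm (x - y) ^ (d - 1) else 0) := by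
    intro y _
    have hk := hK1 (x - y) μ
    have hk0 : 0 ≤ C₁ / nrm (x - y) ^ (d - 1) := div_nonneg hC₁ (pow_nonneg (nrm_pos _).le _)
    have hq0 : 0 ≤ 1 / nrm (x - y) ^ (d - 1) := one_div_nonneg.mpr (pow_nonneg (nrm_pos _).le _)
    -- `|x − (y − e)|_∞` and `|x − y|_∞` differ by at most one
    have hd1 : supNorm (x - (y - e ν)) ≤ supNorm (x - y) + 1 := by
      have := supNorm_add_le (x - y) (e ν)
      rw [show x - (y - e ν) = x - y + e ν by abel]; omega
    have hd2 : supNorm (x - y) ≤ supNorm (x - (y - e ν)) + 1 := by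
      have := supNorm_add_le (x - (y - e ν)) (-(e ν : Site d))
      rw [supNorm_neg] at this
      rw [show x - (y - e ν) + -(e ν : Site d) = x - y by abel] at this; omega
    have hφye : |φ (y - e ν)| ≤ b := hb _
    have hdiff : |φ y - φ (y - e ν)| ≤ b' := by
      have := hb' (y - e ν) ν; rwa [sub_add_cancel] at this
    simp only [hφn]
    by_cases h1 : supNorm (x - y) < ρ <;> by_cases h2 : supNorm (x - (y - e ν)) < ρ <;> simp only [h1, h2, if_true, if_false]
    · -- both near: the oscillation
      rw [abs_mul]
      calc |dG₀ μ (x - y)| * |φ y - φ (y - e ν)| ≤ (C₁ / nrm (x - y) ^ (d - 1)) * b' := mul_le_mul hk hdiff (abs_nonneg _) hk0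
        _ = C₁ * b' * (1 / nrm (x - y) ^ (d - 1)) + 0 := by ring
        _ ≤ C₁ * b' * (1 / nrm (x - y) ^ (d - 1)) + C₁ * b * (if ρ - 1 ≤ supNorm (x - y) ∧ supNorm (x - y) ≤ ρ then 1 / nrm (x - y) ^ (d - 1) else 0) :=
            add_le_add le_rfl (mul_nonneg (mul_nonneg hC₁ hb0) (ite_nonneg hq0 le_rfl))
    · -- `y` near, `y − e` far: layer
      have hlay : ρ - 1 ≤ supNorm (x - y) ∧ supNorm (x - y) ≤ ρ := ⟨by omega, by omega⟩
      rw [if_pos hlay, sub_zero, abs_mul]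
      calc |dG₀ μ (x - y)| * |φ y| ≤ (C₁ / nrm (x - y) ^ (d - 1)) * b := mul_le_mul hk (hb y) (abs_nonneg _) hk0
        _ = 0 + C₁ * b * (1 / nrm (x - y) ^ (d - 1)) := by ring
        _ ≤ C₁ * b' * (1 / nrm (x - y) ^ (d - 1)) + C₁ * b * (1 / nrm (x - y) ^ (d - 1)) :=
            add_le_add (mul_nonneg (mul_nonneg hC₁ hb'0) hq0) le_rfl
    · -- `y` far, `y − e` near: layer
      have hlay : ρ - 1 ≤ supNorm (x - y) ∧ supNorm (x - y) ≤ ρ := ⟨by omega, by omega⟩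
      rw [if_pos hlay, zero_sub, abs_mul, abs_neg]
      calc |dG₀ μ (x - y)| * |φ (y - e ν)| ≤ (C₁ / nrm (x - y) ^ (d - 1)) * b := mul_le_mul hk hφye (abs_nonneg _) hk0
        _ = C₁ * b' * 0 + C₁ * b * (1 / nrm (x - y) ^ (d - 1)) := by ring
    · -- both far: zero
      rw [sub_zero, mul_zero, abs_zero]
      exact add_nonneg (mul_nonneg (mul_nonneg hC₁ hb'0) le_rfl) (mul_nonneg (mul_nonneg hC₁ hb0) (ite_nonneg hq0 le_rfl))
  have hnear : |∑ y ∈ T, dG₀ μ (x - y) * (φn y - φn (y - e ν))| ≤ C₁ * (1 + A * ρ) * b' + 2 * A * C₁ * b := by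
    refine (Finset.abs_sum_le_sum_abs _ _).trans ((Finset.sum_le_sum hnear_pt).trans ?_)
    rw [Finset.sum_add_distrib, ← Finset.mul_sum, ← Finset.mul_sum, ← Finset.sum_filter, ← Finset.sum_filter]
    have hs1 : ∑ y ∈ T.filter (fun y => supNorm (x - y) < ρ), 1 / nrm (x - y) ^ (d - 1) ≤ 1 + A * ρ := by
      refine (sum_reflect_le x _ (cube (0 : Site d) ρ) (fun z => 1 / nrm z ^ (d - 1))
        (fun z => one_div_nonneg.mpr (pow_nonneg (nrm_pos z).le _)) ?_).trans ?_
      · intro y hy; rw [Finset.mem_filter] at hy; rw [mem_cube_zero_iff]; omega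
      · have h := sum_cube_inv_nrm_pow_le (d := d) hd0 ρ (d - 1) le_rfl
        rw [Nat.sub_sub_self (by omega : 1 ≤ d), pow_one] at h
        rw [hA]; exact h
    have hs2 : ∑ y ∈ T.filter (fun y => ρ - 1 ≤ supNorm (x - y) ∧ supNorm (x - y) ≤ ρ), 1 / nrm (x - y) ^ (d - 1) ≤ 2 * A := by
      refine (sum_reflect_le x _ ((cube (0 : Site d) (2 * R + 3)).filter (fun z => ρ - 1 ≤ supNorm z ∧ supNorm z ≤ ρ))
        (fun z => 1 / nrm z ^ (d - 1)) (fun z => one_div_nonneg.mpr (pow_nonneg (nrm_pos z).le _)) ?_).trans ?_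
      · intro y hy; rw [Finset.mem_filter] at hy ⊢; exact ⟨hxT y hy.1, hy.2⟩
      · rw [hA]; exact sum_two_shells_le hd0 _ ρ hρ
    calc C₁ * b' * ∑ y ∈ T.filter (fun y => supNorm (x - y) < ρ), 1 / nrm (x - y) ^ (d - 1)
          + C₁ * b * ∑ y ∈ T.filter (fun y => ρ - 1 ≤ supNorm (x - y) ∧ supNorm (x - y) ≤ ρ), 1 / nrm (x - y) ^ (d - 1)
        ≤ C₁ * b' * (1 + A * ρ) + C₁ * b * (2 * A) :=
          add_le_add (mul_le_mul_of_nonneg_left hs1 (by positivity)) (mul_le_mul_of_nonneg_left hs2 (by positivity))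
      _ = C₁ * (1 + A * ρ) * b' + 2 * A * C₁ * b := by ring
  -- FAR: summation by parts onto the second-difference kernel
  have hφf0 : ∀ y, y ∉ cube c (R + 1) → φf y = 0 := fun y hy => by simp only [hφf, hφ0 y hy, ite_self]
  have hshift : ∑ y ∈ T, dG₀ μ (x - y) * φf (y - e ν) = ∑ y ∈ T, dG₀ μ (x - y - e ν) * φf y := by
    have h := sum_shift T (-(e ν : Site d)) (fun w => dG₀ μ (x - w - e ν) * φf w)
      (fun w hw => by
        have : φf w = 0 := hφf0 w fun h => hw (cube_mono (by omega) h)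
        simp only [this, mul_zero])
      (fun w hw => by
        have hφw : φf w ≠ 0 := by intro h0; apply hw; simp only [h0, mul_zero]
        have hwc : w ∈ cube c (R + 1) := by by_contra h'; exact hφw (hφf0 w h')
        rw [sub_neg_eq_add]
        rw [mem_cube] at hwc ⊢
        intro i
        have h1 := hwc i
        have hs1 : |(e ν : Site d) i| ≤ 1 := by
          change |(Pi.single ν (1 : ℤ) : Site d) i| ≤ 1
          rw [Pi.single_apply]; split_ifs <;> simp
        rw [Pi.add_apply]
        calc |w i + (e ν : Site d) i - c i| = |(w i - c i) + (e ν : Site d) i| := by ring_nf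
          _ ≤ |w i - c i| + |(e ν : Site d) i| := abs_add_le _ _
          _ ≤ ((R + 1 : ℕ) : ℤ) + 1 := add_le_add h1 hs1
          _ = ((R + 2 : ℕ) : ℤ) := by push_cast; ring)
    rw [← h]
    refine Finset.sum_congr rfl fun y _ => ?_
    show dG₀ μ (x - y) * φf (y - e ν) = dG₀ μ (x - (y + -(e ν : Site d)) - e ν) * φf (y + -(e ν : Site d))
    rw [show x - (y + -(e ν : Site d)) - e ν = x - y by abel, show y + -(e ν : Site d) = y - e ν by abel]
  have hfar_eq : ∑ y ∈ T, dG₀ μ (x - y) * (φf y - φf (y - e ν)) = ∑ y ∈ T, (dG₀ μ (x - y) - dG₀ μ (x - y - e ν)) * φf y := by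
    simp only [mul_sub, Finset.sum_sub_distrib, hshift, sub_mul]
  have hfar_pt : ∀ y ∈ T, |(dG₀ μ (x - y) - dG₀ μ (x - y - e ν)) * φf y|
      ≤ C₂ * 2 ^ d * b * (if ρ ≤ supNorm (x - y) then 1 / nrm (x - y) ^ d else 0) := by
    intro y _
    simp only [hφf]
    by_cases h1 : supNorm (x - y) < ρ
    · rw [if_pos h1, mul_zero, abs_zero, if_neg (by omega)]; simp
    rw [if_neg h1, if_pos (by omega), abs_mul]
    -- the second difference at base `x − y − e ν`, which keeps half the norm of `x − y`
    have hk := hK2 (x - y - e ν) μ ν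
    rw [sub_add_cancel] at hk
    have hhalf : nrm (x - y) / 2 ≤ nrm (x - y - e ν) := by
      have := half_nrm_le_nrm_add (x - y) (-(e ν : Site d)) (by
        rw [supNorm_neg]
        have h2 : (supNorm (e ν : Site d) : ℝ) ≤ 1 := by exact_mod_cast hsupe
        have h3 : (ρ : ℝ) ≤ supNorm (x - y) := by exact_mod_cast (not_lt.1 h1)
        have h4 : (2 : ℝ) ≤ ρ := by exact_mod_cast hρ
        linarith [supNorm_le_nrm (x - y)])
      rwa [← sub_eq_add_neg] at this
    have hnv := nrm_pos (x - y)
    have hnb := nrm_pos (x - y - e ν)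
    have hk' : |dG₀ μ (x - y) - dG₀ μ (x - y - e ν)| ≤ C₂ * 2 ^ d / nrm (x - y) ^ d := by
      refine hk.trans ?_
      rw [div_le_div_iff₀ (pow_pos hnb d) (pow_pos hnv d)]
      calc C₂ * nrm (x - y) ^ d ≤ C₂ * (2 * nrm (x - y - e ν)) ^ d := by
            apply mul_le_mul_of_nonneg_left _ hC₂
            exact pow_le_pow_left₀ hnv.le (by linarith) _
        _ = C₂ * 2 ^ d * nrm (x - y - e ν) ^ d := by rw [mul_pow]; ring
    calc |dG₀ μ (x - y) - dG₀ μ (x - y - e ν)| * |φ y| ≤ (C₂ * 2 ^ d / nrm (x - y) ^ d) * b :=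
          mul_le_mul hk' (hb y) (abs_nonneg _) (div_nonneg (by positivity) (pow_nonneg hnv.le _))
      _ = C₂ * 2 ^ d * b * (1 / nrm (x - y) ^ d) := by ring
  have hfar : |∑ y ∈ T, dG₀ μ (x - y) * (φf y - φf (y - e ν))|
      ≤ C₂ * 2 ^ d * (A * (1 + Real.posLog (((2 * R + 3 : ℕ) : ℝ) / ρ))) * b := by
    rw [hfar_eq]
    refine (Finset.abs_sum_le_sum_abs _ _).trans ((Finset.sum_le_sum hfar_pt).trans ?_)
    rw [← Finset.mul_sum, ← Finset.sum_filter]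
    have hs : ∑ y ∈ T.filter (fun y => ρ ≤ supNorm (x - y)), 1 / nrm (x - y) ^ d ≤ A * (1 + Real.posLog (((2 * R + 3 : ℕ) : ℝ) / ρ)) := by
      refine (sum_reflect_le x _ ((cube (0 : Site d) (2 * R + 3)).filter (fun z => ρ ≤ supNorm z)) (fun z => 1 / nrm z ^ d)
        (fun z => one_div_nonneg.mpr (pow_nonneg (nrm_pos z).le _)) ?_).trans ?_
      · intro y hy; rw [Finset.mem_filter] at hy ⊢; exact ⟨hxT y hy.1, hy.2⟩
      · rw [hA]; exact sum_cube_far_inv_nrm_pow_le hd0 _ _ (by omega)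
    have hP0 : 0 ≤ Real.posLog (((2 * R + 3 : ℕ) : ℝ) / ρ) := Real.posLog_nonneg
    calc C₂ * 2 ^ d * b * ∑ y ∈ T.filter (fun y => ρ ≤ supNorm (x - y)), 1 / nrm (x - y) ^ d
        ≤ C₂ * 2 ^ d * b * (A * (1 + Real.posLog (((2 * R + 3 : ℕ) : ℝ) / ρ))) := mul_le_mul_of_nonneg_left hs (by positivity)
      _ = _ := by ring
  -- total
  rw [hsum]
  calc _ ≤ |∑ y ∈ T, dG₀ μ (x - y) * (φn y - φn (y - e ν))| + |∑ y ∈ T, dG₀ μ (x - y) * (φf y - φf (y - e ν))| := abs_add_le _ _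
    _ ≤ (C₁ * (1 + A * ρ) * b' + 2 * A * C₁ * b) + C₂ * 2 ^ d * (A * (1 + Real.posLog (((2 * R + 3 : ℕ) : ℝ) / ρ))) * b :=
        add_le_add hnear hfar
    _ = _ := by rw [hA]

end

end Summit.QuantumFields.BalabanUV.T4Continuum.NE7FlatGradientLogCurlPrep
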